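import Literature.Analysis.FluidPDE.FluidComputer.ThresholdLevelTableA3
import HarnessLib

/-!
# Kernel run of the A = 3 level-table checker, chunks 8 … 11 (steps 200 … 299) (bp3 gen 13, layer 4)

HONEST FRAMING: low prior, high value-of-information experiment on Tao's machine paradigm; NOT a
claim that NS blows up.

Four kernel evaluations (`decide +kernel`; no `native_decide`, no extra axioms) of the checker
`runSteps` (`ThresholdLevelCheck.lean`) on 25 steps of `ThresholdLevelTableA3.stepsT` at a time, from
the entry box `Bc i` towards the next chunk's first level, returning the entry box `Bc (i+1)`
(≈ 30 s of kernel time per chunk; same scheme as `ThresholdLevelTableRun0 … 7` for A = 2).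
-/

namespace Literature.Analysis.FluidPDE.FluidComputer

namespace ThresholdLevelTableA3

set_option maxHeartbeats 10000000 in
set_option maxRecDepth 200000 in
/-- Chunk 8 of the A = 3 table run (steps 200 … 224). [folklore] -/
theorem run8 : runSteps 60 12 3 GIt RbIt Bc8 chunk8 1528252069265246 = some Bc9 := by
  decide +kernel

set_option maxHeartbeats 10000000 in
set_option maxRecDepth 200000 in
/-- Chunk 9 of the A = 3 table run (steps 225 … 249). [folklore] -/
theorem run9 : runSteps 60 12 3 GIt RbIt Bc9 chunk9 1822168356222493 = some Bc10 := by
  decide +kernel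

set_option maxHeartbeats 10000000 in
set_option maxRecDepth 200000 in
/-- Chunk 10 of the A = 3 table run (steps 250 … 274). [folklore] -/
theorem run10 : runSteps 60 12 3 GIt RbIt Bc10 chunk10 2172611171411610 = some Bc11 := by
  decide +kernel

set_option maxHeartbeats 10000000 in
set_option maxRecDepth 200000 in
/-- Chunk 11 of the A = 3 table run (steps 275 … 299). [folklore] -/
theorem run11 : runSteps 60 12 3 GIt RbIt Bc11 chunk11 2590451802119962 = some Bc12 := by
  decide +kernel

end ThresholdLevelTableA3

end Literature.Analysis.FluidPDE.FluidComputer
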